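import Mathlib
import Literature.NumberTheory.LFunctions.Zhang2022.ToolkitBErrorChainBlock
import Literature.NumberTheory.LFunctions.Zhang2022.Section14Prop141Twisted
import Literature.NumberTheory.LFunctions.Zhang2022.Section14Eq143Core
import HarnessLib

/-!
# Zhang (2022) §14, (14.8) large-conductor leg at general `β`: the per-block bound at the §14 instance
# (coefficients `κ*(d·)`, weight `χ(p)(pt₀)^β`), kernel-checked

Topic `Literature/NumberTheory/LFunctions/Zhang2022` (Landau–Siegel audit tree; verdict-neutral).
Y. Zhang, *Discrete mean estimates and the Landau–Siegel zero*, arXiv:2211.02515v1 (2022)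
[Zhang2022LandauSiegel] — **an unrefereed manuscript under adjudication**; nothing here asserts or
denies its Theorems 1–2 or Proposition 14.1. ZHANG-L discharge lane, helper under the leaf
`Skeleton.Prop141` (GAP row G-adj2-4 "the (14.8)-left-side bound … for `D³ ≤ r < 2DP₄` (Mellin +
L5.4(i) + large sieve leg)"; zl-closer-5's WANTED.md v1 §2 W-leg2; the per-block hypothesis of the
dyadic aggregation B4/LegLarge).

The manuscript (p. 79, tex L3960–L3963): "The range for `r` is divided into two parts according to
`1 < r < D³` and `D³ ≤ r < 2DP₄`. In a way similar to the proof of Proposition 7.1 … for `D³ ≤ r < 2DP₄`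
we use the Mellin transform, Lemma 5.4 (i) and the large sieve inequality" (and "the general case is
almost identical", p. 76, for the weight `(pt₀)^β`). The §7 model is (7.15) and §7.u036–u041. The tree
holds the whole per-block chain GENERICALLY (`ToolkitBErrorChain`, `ToolkitBErrorChainMellin`,
`ToolkitBErrorChainBlock`: localisation `𝔰 ↦ 𝔰*`, Mellin step, the two large sieves, Cauchy). This
file instantiates it at the §14 data — `l`-coefficients `κ*(dl)` under (14.1) `|κ*| ≤ Bτ₅`, prime
weight `χ(p)(pt₀)^β` with `‖β‖ < 5α` (`‖(pt₀)^β‖ ≤ e^{15π}`, `Typed.Sec14.norm_wt_le`) — and proves,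
for the summand of the twisted u017 majorant `Typed.Sec14.rhs1417OnW χ β κs` (β = 0: `rhs1417On`):

* `legTwo_block_bound` — `∀ B, ∃ k C, ForAllLarge: ∀ β, ‖β‖ < 5α → ∀ κs, (14.1) → ∀ d h R,
  1 ≤ d ≤ 2P₄ → 1 ≤ h → 1 ≤ R → Rh ≤ P →
  R^{−3/2} Σ_{R≤r<2R} Σ_{θ prim mod r, θ↑ ≠ χ↑} ‖Σ'_{(l,h)=1} κ*(dl)θ(l) Σ_{p∼P} χθ̄(p)(pt₀)^β Δ(l/(phr))‖
    ≤ C·τ₅(d)·h·𝓛ᵏ·(R^{1/2}P^{3/2} + R^{−1/2}P²)` (`k = 5315`),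
  the u041-left shape of §7 with the §14 ranges; the factor `D/(φ(hr)h√r)` and the sums over
  `d, h, R ≥ D³` are the aggregation's (B4).
* `frakSGen_sec14_eq` — the summand is `‖BErrorChain.frakSGen D (κ*(d·)) (χ·(·t₀)^β) r h θ‖`.

## References

* Y. Zhang, arXiv:2211.02515v1 (2022), §14 p. 79 (14.8), tex L3945–L3963; §7 (7.15) pp. 38–39.
  [cite: Zhang2022LandauSiegel, §14 (14.8) p.79; §7 (7.15) pp.38–39]
-/

noncomputable section

open Complex Real
open Literature.NumberTheory.LFunctions.Zhang2022
open Literature.NumberTheory.LFunctions.Zhang2022.Section7cStatements (natI dyadic)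
open Literature.NumberTheory.LFunctions.Zhang2022.BErrorChain

namespace Literature.NumberTheory.LFunctions.Zhang2022.Typed.Sec14

open Skeleton

/-! ### `τ₅` in the shape of (14.1) -/

/-- `τ₅` in the shape of (14.1) is the tree's `MeanSquareMajorant.tau 5`.
[cite: Zhang2022LandauSiegel, §14 (14.1) p.76] -/
private theorem tau_five_eq' (n : ℕ) :
    (((ArithmeticFunction.zeta ^ 5 : ArithmeticFunction ℕ)) n : ℝ) = MeanSquareMajorant.tau 5 n := by
  have h : ∀ i : ℕ, ((ArithmeticFunction.zeta ^ i : ArithmeticFunction ℕ) : ArithmeticFunction ℝ) =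
      (ArithmeticFunction.zeta : ArithmeticFunction ℝ) ^ i := by
    intro i
    induction i with
    | zero => rw [pow_zero, pow_zero, ArithmeticFunction.natCoe_one]
    | succ i ih => rw [pow_succ, pow_succ, ArithmeticFunction.natCoe_mul, ih]
  rw [MeanSquareMajorant.tau, ← h, ArithmeticFunction.natCoe_apply]

/-- Under (14.1), `‖κ*(m)‖ ≤ B·τ₅(m)` with the tree's `τ₅`, and `B ≥ 0`.
[cite: Zhang2022LandauSiegel, §14 (14.1) p.76] -/
theorem norm_le_tau_five_of_eq141 {B : ℝ} {κs : ℕ → ℂ} (hκ : Eq141 B κs) :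
    (∀ m : ℕ, ‖κs m‖ ≤ B * MeanSquareMajorant.tau 5 m) ∧ 0 ≤ B := by
  have h1 : ∀ m : ℕ, ‖κs m‖ ≤ B * MeanSquareMajorant.tau 5 m := fun m => by
    rw [← tau_five_eq']; exact hκ m
  refine ⟨h1, ?_⟩
  have h := h1 1
  rw [MeanSquareMajorant.tau_apply_one, mul_one] at h
  exact (norm_nonneg _).trans h

/-! ### The summand of the twisted u017 majorant is the generic `𝔰` -/

/-- The summand of `rhs1417OnW χ β κs` at `(d, r, h, θ)` is the generic series
`BErrorChain.frakSGen D c w r h θ` with `c(l) = κ*(dl)` and `w(p) = χ(p)(pt₀)^β`.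
[cite: Zhang2022LandauSiegel, §14 u017 p.79, tex L3956] -/
theorem frakSGen_sec14_eq {D : ℕ} (χ : DirichletCharacter ℂ D) (β : ℂ) (κs : ℕ → ℂ)
    (d r h : ℕ) (θ : DirichletCharacter ℂ r) :
    frakSGen D (fun l => κs (d * l)) (fun p => χ (p : ZMod D) * wt D β p) r h θ =
      ∑' l : ℕ, if Nat.Coprime l h then
        κs (d * l) * θ (l : ZMod r) *
          ∑ p ∈ primeWindow D, χ (p : ZMod D) * θ⁻¹ (p : ZMod r) * wt D β p *
            DeltaW D ((l : ℝ) / ((p : ℝ) * h * r)) else 0 := by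
  unfold frakSGen
  refine tsum_congr fun l => ?_
  split_ifs with hl
  · congr 1
    exact Finset.sum_congr rfl fun p _ => by ring
  · rfl

/-! ### The per-block bound at the §14 instance -/

/-- `2t₀ ≤ T²` eventually, hence `2P₄ ≤ P` (`P₄ = PT⁻²t₀`). [cite: Zhang2022LandauSiegel, §6 p.30 (`P₄`)] -/
theorem two_P4_le_bigP_eventually : ∃ D₀ : ℕ, ∀ D : ℕ, D₀ ≤ D → 2 * P4 D ≤ bigP D := by
  obtain ⟨D₀, hD₀⟩ := Eq143.pow_le_bigT 519 2
  refine ⟨D₀, fun D hD => ?_⟩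
  have hT := hD₀ D hD
  have hT1 : 1 ≤ bigT D := Real.one_le_exp (by
    rw [ell]; exact Real.rpow_nonneg (Real.log_natCast_nonneg D) _)
  have hT0 : 0 < bigT D := by linarith
  have hP0 : 0 < bigP D := bigP_pos D
  have ht0 : t0 D = ell D ^ 519 := rfl
  have h2t : 2 * t0 D ≤ bigT D ^ 2 := by
    rw [ht0]
    calc 2 * ell D ^ 519 ≤ bigT D := hT
      _ = bigT D * 1 := (mul_one _).symm
      _ ≤ bigT D * bigT D := mul_le_mul_of_nonneg_left hT1 hT0.le
      _ = bigT D ^ 2 := (sq _).symm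
  rw [P4]
  calc 2 * (bigP D / bigT D ^ 2 * t0 D) = bigP D * (2 * t0 D) / bigT D ^ 2 := by ring
    _ ≤ bigP D * bigT D ^ 2 / bigT D ^ 2 := by gcongr
    _ = bigP D := by field_simp

open scoped Classical in
/-- **The per-block bound of the (14.8)/(14.6) large-conductor leg at the §14 instance, general `β`**
(zl-closer-5 WANTED.md W-leg2, per block; the hypothesis of the aggregation B4): for every `B` there
are `k` (`= 5315`) and `C` such that for all large `D` (all real primitive `χ`), every `β` with
`‖β‖ < 5α`, every `κ*` with (14.1) `|κ*(m)| ≤ Bτ₅(m)`, all `1 ≤ d ≤ 2P₄`, `h ≥ 1`, `1 ≤ R`, `Rh ≤ P`: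
`R^{−3/2} Σ_{R≤r<2R} Σ_{θ prim mod r, θ↑≠χ↑} ‖Σ'_{(l,h)=1} κ*(dl)θ(l) Σ_{p∼P} χ(p)θ̄(p)(pt₀)^β Δ(l/(phr))‖
  ≤ C·τ₅(d)·h·𝓛ᵏ·(R^{1/2}P^{3/2} + R^{−1/2}P²)`.
Route: the generic `BErrorChain.dyadic_block_bound_frakSGen_tau5_filter` with `c(l) = κ*(dl)`,
`w(p) = χ(p)(pt₀)^β` (`‖w‖ ≤ e^{15π}`, `norm_wt_le`), `d ≤ 2P₄ ≤ P` (`two_P4_le_bigP_eventually`), the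
summand identity `frakSGen_sec14_eq`, and `finsetOf {θ | …} = univ.filter …`.
[cite: Zhang2022LandauSiegel, §14 (14.8) p.79, tex L3962–L3963; §7 (7.15) p.39, tex L2055] -/
theorem legTwo_block_bound :
    ∀ B : ℝ, ∃ k : ℕ, ∃ C : ℝ, ForAllLarge fun D _ χ => ∀ β : ℂ, ‖β‖ < 5 * alpha D →
      ∀ κs : ℕ → ℂ, Eq141 B κs → ∀ (d h : ℕ) (R : ℝ), 1 ≤ d → (d : ℝ) ≤ 2 * P4 D → 1 ≤ h →
        1 ≤ R → R * h ≤ bigP D →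
          R ^ (-(3 / 2 : ℝ)) * ∑ r ∈ dyadic R,
              ∑ θ ∈ finsetOf {θ : DirichletCharacter ℂ r | θ.IsPrimitive ∧
                  DirichletCharacter.changeLevel (dvd_mul_left r D) θ ≠
                    DirichletCharacter.changeLevel (dvd_mul_right D r) χ},
                ‖∑' l : ℕ, if Nat.Coprime l h then
                    κs (d * l) * θ (l : ZMod r) *
                      ∑ p ∈ primeWindow D, χ (p : ZMod D) * θ⁻¹ (p : ZMod r) * wt D β p *
                        DeltaW D ((l : ℝ) / ((p : ℝ) * h * r)) else 0‖ ≤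
            C * MeanSquareMajorant.tau 5 d * (h : ℝ) * ell D ^ k *
              (R ^ (1 / 2 : ℝ) * bigP D ^ (3 / 2 : ℝ) + R ^ (-(1 / 2 : ℝ)) * bigP D ^ 2) := by
  intro B
  obtain ⟨C₀, hC₀, D₁, hblk⟩ := dyadic_block_bound_frakSGen_tau5_filter
  obtain ⟨D₂, hD₂⟩ := exists_nat_forall_le_ell 3
  obtain ⟨D₃, hD₃⟩ := two_P4_le_bigP_eventually
  set M : ℝ := Real.exp (15 * π) with hM
  have hM0 : 0 ≤ M := (Real.exp_pos _).le
  refine ⟨5315, C₀ * B * M, max (max D₁ D₂) D₃,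
    fun D _ χ hD hq hp β hβ κs hκ d h R hd hd4 hh hR hRhP => ?_⟩
  have hD₁ : D₁ ≤ D := le_trans (le_trans (le_max_left _ _) (le_max_left _ _)) hD
  have hℓ3 : 3 ≤ ell D := hD₂ D (le_trans (le_trans (le_max_right _ _) (le_max_left _ _)) hD)
  have h2P4 : 2 * P4 D ≤ bigP D := hD₃ D (le_trans (le_max_right _ _) hD)
  obtain ⟨hκ', -⟩ := norm_le_tau_five_of_eq141 hκ
  have hd0 : 0 < d := by omega
  -- the data of the generic block bound
  set c : ℕ → ℂ := fun l => κs (d * l) with hc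
  set w : ℕ → ℂ := fun p => χ (p : ZMod D) * wt D β p with hw
  have hcB : ∀ l : ℕ, ‖c l‖ ≤ B * MeanSquareMajorant.tau 5 (d * l) := fun l => hκ' (d * l)
  have hwM : ∀ p ∈ primeWindow D, ‖w p‖ ≤ M := by
    intro p hpw
    calc ‖w p‖ = ‖χ (p : ZMod D)‖ * ‖wt D β p‖ := norm_mul _ _
      _ ≤ 1 * M := mul_le_mul (DirichletCharacter.norm_le_one χ _) (norm_wt_le hℓ3 hpw hβ.le)
          (norm_nonneg _) zero_le_one
      _ = M := one_mul M
  have hdP : (d : ℝ) ≤ bigP D := hd4.trans h2P4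
  have hgen := hblk D χ hD₁ hq hp
    (fun r θ => DirichletCharacter.changeLevel (dvd_mul_left r D) θ ≠
      DirichletCharacter.changeLevel (dvd_mul_right D r) χ)
    c w B M d h R hcB hwM hM0 hd0 hdP (by omega) hR hRhP
  -- the `finsetOf` sums are the `filter` sums of `‖frakSGen …‖` (membership-level, instance-free)
  have hsets : ∀ r : ℕ, ∀ θ : DirichletCharacter ℂ r,
      θ ∈ finsetOf {θ : DirichletCharacter ℂ r | θ.IsPrimitive ∧
          DirichletCharacter.changeLevel (dvd_mul_left r D) θ ≠
            DirichletCharacter.changeLevel (dvd_mul_right D r) χ} ↔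
        θ.IsPrimitive ∧ DirichletCharacter.changeLevel (dvd_mul_left r D) θ ≠
          DirichletCharacter.changeLevel (dvd_mul_right D r) χ := by
    intro r θ
    rw [mem_finsetOf (Set.toFinite _), Set.mem_setOf_eq]
  refine le_trans (le_of_eq ?_) (le_of_le_of_eq hgen (by ring))
  congr 1
  refine Finset.sum_congr rfl fun r _ => ?_
  refine Finset.sum_congr ?_ fun θ _ => by rw [frakSGen_sec14_eq χ β κs d r h θ]
  ext θ
  -- the `DecidablePred` instance of the target filter is taken by unification (`(_)`), not synthesis
  exact (hsets r θ).trans ⟨fun h' => (@Finset.mem_filter _ _ (_) _ θ).mpr ⟨Finset.mem_univ θ, h'⟩,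
    fun h' => ((@Finset.mem_filter _ _ (_) _ θ).mp h').2⟩

open scoped Classical in
/-- **The `β = 0` case** (the summand of the typed u017 majorant `Typed.Sec14.rhs1417On χ κs`, node
`Z22:(14.8)` second `r`-range `Eq148leg2`, per block): same bound without the twist.
[cite: Zhang2022LandauSiegel, §14 (14.8) p.79, tex L3962–L3963] -/
theorem legTwo_block_bound_zero :
    ∀ B : ℝ, ∃ k : ℕ, ∃ C : ℝ, ForAllLarge fun D _ χ =>
      ∀ κs : ℕ → ℂ, Eq141 B κs → ∀ (d h : ℕ) (R : ℝ), 1 ≤ d → (d : ℝ) ≤ 2 * P4 D → 1 ≤ h →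
        1 ≤ R → R * h ≤ bigP D →
          R ^ (-(3 / 2 : ℝ)) * ∑ r ∈ dyadic R,
              ∑ θ ∈ finsetOf {θ : DirichletCharacter ℂ r | θ.IsPrimitive ∧
                  DirichletCharacter.changeLevel (dvd_mul_left r D) θ ≠
                    DirichletCharacter.changeLevel (dvd_mul_right D r) χ},
                ‖∑' l : ℕ, if Nat.Coprime l h then
                    κs (d * l) * θ (l : ZMod r) *
                      ∑ p ∈ primeWindow D, χ (p : ZMod D) * θ⁻¹ (p : ZMod r) *
                        DeltaW D ((l : ℝ) / ((p : ℝ) * h * r)) else 0‖ ≤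
            C * MeanSquareMajorant.tau 5 d * (h : ℝ) * ell D ^ k *
              (R ^ (1 / 2 : ℝ) * bigP D ^ (3 / 2 : ℝ) + R ^ (-(1 / 2 : ℝ)) * bigP D ^ 2) := by
  intro B
  obtain ⟨k, C, D₀, hall⟩ := legTwo_block_bound B
  obtain ⟨D₂, hD₂⟩ := exists_nat_forall_le_ell 3
  refine ⟨k, C, max D₀ D₂, fun D _ χ hD hq hp κs hκ d h R hd hd4 hh hR hRhP => ?_⟩
  have hℓ3 : 3 ≤ ell D := hD₂ D (le_trans (le_max_right _ _) hD)
  have hα : 0 < alpha D := alpha_pos' (by linarith)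
  have hβ : ‖(0 : ℂ)‖ < 5 * alpha D := by rw [norm_zero]; positivity
  have h1 := hall D χ (le_trans (le_max_left _ _) hD) hq hp 0 hβ κs hκ d h R hd hd4 hh hR hRhP
  simpa only [wt_zero, mul_one] using h1

end Literature.NumberTheory.LFunctions.Zhang2022.Typed.Sec14
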